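import Mathlib
import HarnessLib
import HarnessLib.Audit
import Literature.NumberTheory.GaloisRepresentations.LAdicRepFrobenius
import Literature.NumberTheory.GaloisRepresentations.FramedGaloisRepSemisimplification
import Literature.NumberTheory.GaloisRepresentations.FramedRepEquivConj
import Literature.NumberTheory.GaloisRepresentations.FramedRepDualIrreducible
import Literature.NumberTheory.GaloisRepresentations.FramedRepBaseChange
import Literature.NumberTheory.GaloisRepresentations.IntegralGaloisActionProofs
import Literature.NumberTheory.EllipticCurves.FramedTateGaloisRep
import Literature.NumberTheory.Automorphic.ChebotarevArtinRepHolds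
import Literature.NumberTheory.Automorphic.HilbertModularGaloisRep
import Literature.NumberTheory.Automorphic.HilbertModularGaloisRepUnramified
import Literature.NumberTheory.Automorphic.ReciprocityGLnPotentialModularityTateProofs
import Literature.NumberTheory.Automorphic.TotallyRealModularity
import Literature.NumberTheory.Automorphic.CaraianiNewtonModularity
import Literature.FieldTheory.AlgClosed.PadicAlgClEquivComplex

/-!
# WeakStrongBridge — WEAK modularity ⟹ weight-zero AUTOMORPHY of elliptic curves over totally real fields
(lens-5 g37, kit 7, file A of 2; pure proof file — no `def`, no `sorry`, standard axioms)

THESIS.  The tree carries two renderings of "the elliptic curve `E / 𝓞 K` is modular":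
* WEAK (cofinite TRACE matching) — `IsHilbertModular E` (TotallyRealModularity: a weight-zero cuspidal `π` on `GL₂/K`
  whose Hecke polynomial at ALMOST ALL `w` is `X² - a_w(E)X + q_w`) and `IsModularEllipticCurve K E` (CaraianiNewtonModularity:
  CM, or a weight-zero `π` whose `T_w`-eigenvalue `√q_w · Σα` equals `a_w(E)` at almost all `w`) — the form in which the
  LITERATURE modularity theorems are typed (`FLS2015_theorem1`, `Box2022_theorem1_1`, `CaraianiNewton2023_theorem1_1`, the live
  item `EllipticDegreeLadder.QuarticModularity` = stmt-Langlands-17832);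
* STRONG (Hecke polynomial at EVERY place `w ∤ Δ(E)`) — `IsAutomorphicOfWeightZero E` (ReciprocityGLnPotentialModularityTate),
  the form the summit side consumes (`QuarticLiftSplit.SqrtFiveQuarticAutomorphy`, the lens-5 residual chain).
Strong ⟹ weak is in the tree (`IsHilbertModular.of_isAutomorphicOfWeightZero`, `IsModularEllipticCurve.of_isAutomorphicOfWeightZero`);
the converse was NOT (kit-6 card §4: "no weak → strong lemma exists in the tree").  THIS FILE PROVES IT over totally real `K`,
modulo three tree-NAMED print facts used as hypotheses: `h27 : exists_galoisRep_of_regularAlgebraic` (lang.S27: Galois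
representations of regular algebraic cuspidal `π` on `GL₂` over totally real fields, with unramified local–global compatibility —
Carayol, Blasius–Rogawski, Taylor), `hirr : galoisRep_GL2_totallyReal_irreducible` (Ribet/Taylor irreducibility) and
`hCar : Carayol1986_unramifiedCompatibility` (unramified `π_w` at places where `r_π` is unramified, `w ∤ ℓ`).

PROOF (all in this file).  §0 Chebotarev + Brauer–Nesbitt by TRACES (`nonempty_equiv_of_trace_frobenius_eventually`: two semisimple
`ℓ`-adic Galois representations with equal Frobenius TRACES at almost all places are isomorphic — the weak clause only identifies the
trace, so the tree's charpoly version does not apply).  §1 algebra of quadratic characteristic polynomials and of the rank-2 Satake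
polynomial (reusing the tree's `X_sub_C_mul_X_sub_C`).  §2 at one place `w ∤ ℓ·Δ`: `r_π(ℓ)^∨` and
the semisimplified Tate representation `V_ℓ(E)^ss` have equal traces at almost all Frobenii (weak clause + Hasse–Weil at good places +
unramified compatibility of `r_π`), hence are isomorphic (§0); `V_ℓ(E)` is unramified at `w` (good reduction, `w ∤ ℓ`) so `r_π` is, so
`π_w` is unramified (`hCar`) with Satake pair `β`, and transporting the Frobenius charpoly through the isomorphism pins `β` down
(`hasHeckePolynomialAt_of_weak_of_not_mem`).  §3 = §2 at `ℓ = 2` and `ℓ = 3` (`w` divides at most one):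
`isAutomorphicOfWeightZero_of_weak`, the `IsHilbertModular` / `IsModularEllipticCurve` corollaries and the two `iff`s.  File B
(`WeakStrongBridgeQuarticLift`) applies §3 to the lens-5 residual chain (kit 6's binder Q5A).

HONEST.  Conditional on `h27 ∧ hirr ∧ hCar` (print, typed in the tree as named `Prop`s, not proved there); nothing here proves any
curve modular; the CM branch of `IsModularEllipticCurve` is NOT bridged here (automorphic induction — file B vendors it as a print
binder).  In print the two renderings are used interchangeably ("a more conceptual way to phrase this is that there is an isomorphism
of compatible systems", Freitas–Le Hung–Siksek 2015 §1, via Carayol); the content of this file is the tree-level formalisation of that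
remark. [cite: CarayolASENS1986, Thm. (A)] [cite: DeligneSerreASENS1974, Lemme 3.2] [cite: Taylor1995HMFII, Thm. 1.1]
-/

set_option linter.dupNamespace false -- project-wide option; `Summit.Langlands.Langlands` is the mandated namespace

open scoped NumberField MatrixGroups Matrix
open NumberField Field IsDedekindDomain Polynomial Filter
open Literature.NumberTheory.Automorphic
open Literature.NumberTheory.GaloisRepresentations
open Literature.NumberTheory.EllipticCurves

namespace Summit.Langlands.Langlands.Theorems.WeakStrongBridge

/-! ## §0  Chebotarev–Brauer–Nesbitt by TRACES of Frobenius -/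

section TraceBN

variable {K : Type} [Field K] [NumberField K] {A : Type*} [Field A] [TopologicalSpace A]
  [IsTopologicalRing A] {n : ℕ}

/-- **Semisimple Galois representations with the same Frobenius TRACES at almost all places are isomorphic**
(Deligne–Serre 1974, Lemme 3.2, "resp. les traces"): the trace form of the tree's
`FramedGaloisRep.nonempty_equiv_of_hasFrobCharpolyAt_eventually` (same proof: the coincidence set of the two
traces is closed and contains the dense set of Frobenius elements over the good places,
`absoluteGaloisGroup.frobenius_dense`; then Brauer–Nesbitt in characteristic `0`).  Needed because the WEAK
modularity clause only identifies the TRACE `a_v` of Frobenius, not its determinant.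
[cite: DeligneSerreASENS1974, Lemme 3.2 (p. 513)] -/
theorem nonempty_equiv_of_trace_frobenius_eventually [T2Space A] [CharZero A]
    (hC : Literature.NumberTheory.Automorphic.chebotarev_artinRep) (r r' : FramedGaloisRep K A n)
    (hr : r.toGaloisRep.IsSemisimple) (hr' : r'.toGaloisRep.IsSemisimple)
    (h : ∀ᶠ v : HeightOneSpectrum (𝓞 K) in cofinite, ∀ 𝔓 ∈ v.primesAbove,
      ∀ σ : absoluteGaloisGroup K, IsArithFrobAt (𝓞 K) σ 𝔓 → FramedRep.trace r σ = FramedRep.trace r' σ) :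
    Nonempty (ContinuousRep.Equiv r.toGaloisRep r'.toGaloisRep) := by
  classical
  set S : Set (HeightOneSpectrum (𝓞 K)) := {v | ¬ (∀ 𝔓 ∈ v.primesAbove,
      ∀ σ : absoluteGaloisGroup K, IsArithFrobAt (𝓞 K) σ 𝔓 → FramedRep.trace r σ = FramedRep.trace r' σ)}
    with hSdef
  have hS : S.Finite := Filter.eventually_cofinite.1 h
  set D : Set (absoluteGaloisGroup K) :=
    {σ | ∃ v ∉ S, ∃ 𝔓 ∈ v.primesAbove, IsArithFrobAt (𝓞 K) σ 𝔓} with hDdef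
  have hF : D ⊆ {σ | FramedRep.trace r σ = FramedRep.trace r' σ} := by
    rintro σ ⟨v, hv, 𝔓, h𝔓, hσ⟩
    simp only [hSdef, Set.mem_setOf_eq, not_not] at hv
    exact hv 𝔓 h𝔓 σ hσ
  have hclosed :
      IsClosed {σ : absoluteGaloisGroup K | FramedRep.trace r σ = FramedRep.trace r' σ} :=
    isClosed_eq (FramedRep.continuous_trace r) (FramedRep.continuous_trace r')
  have hall : ∀ σ, FramedRep.trace r σ = FramedRep.trace r' σ := by
    intro σ
    have hmem : σ ∈ closure D := by
      rw [(absoluteGaloisGroup.frobenius_dense hC K S hS).closure_eq]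
      exact Set.mem_univ σ
    exact hclosed.closure_subset_iff.2 hF hmem
  have hchar : r.toGaloisRep.toRepresentation.character =
      r'.toGaloisRep.toRepresentation.character := by
    funext σ
    rw [FramedGaloisRep.character_toRepresentation, FramedGaloisRep.character_toRepresentation,
      hall σ]
  haveI : r.toGaloisRep.toRepresentation.IsSemisimpleRepresentation := hr
  haveI : r'.toGaloisRep.toRepresentation.IsSemisimpleRepresentation := hr'
  obtain ⟨e⟩ :=
    Literature.RepresentationTheory.Semisimple.Representation.nonempty_equiv_of_character_eq_of_isSemisimple
      _ _ hchar
  exact ⟨⟨e, LinearMap.continuous_on_pi e.toLinearEquiv.toLinearMap,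
    LinearMap.continuous_on_pi e.toLinearEquiv.symm.toLinearMap⟩⟩

end TraceBN

/-! ## §1  Quadratic characteristic polynomials: trace, non-vanishing determinant, the Satake polynomial -/

section Quadratic

variable {K : Type} [Field K] {A : Type*} [Field A] [TopologicalSpace A]

/-- If the arithmetic Frobenius `σ` has characteristic polynomial `X² - sX + p` on `ρ`, its trace is `s`. [folklore] -/
theorem trace_eq_of_charpoly_eq_quadratic (ρ : FramedGaloisRep K A 2) (σ : absoluteGaloisGroup K) {s p : A}
    (h : FramedRep.charpoly ρ σ = X ^ 2 - C s * X + C p) : FramedRep.trace ρ σ = s := by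
  unfold FramedRep.trace
  rw [Matrix.trace_eq_neg_charpoly_coeff]
  change -((FramedRep.charpoly ρ σ).coeff (Fintype.card (Fin 2) - 1)) = s
  rw [h]
  simp [coeff_C]

/-- If the arithmetic Frobenius `σ` has characteristic polynomial `X² - sX + p` on `ρ : Γ_K → GL₂(A)`, then `p = det ρ(σ) ≠ 0`.
[folklore] -/
theorem coeff_zero_ne_zero_of_charpoly_eq_quadratic (ρ : FramedGaloisRep K A 2) (σ : absoluteGaloisGroup K)
    {s p : A} (h : FramedRep.charpoly ρ σ = X ^ 2 - C s * X + C p) : p ≠ 0 := by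
  have hdet : ((ρ σ : GL (Fin 2) A) : Matrix (Fin 2) (Fin 2) A).det = p := by
    rw [Matrix.det_eq_sign_charpoly_coeff]
    change (-1 : A) ^ Fintype.card (Fin 2) * (FramedRep.charpoly ρ σ).coeff 0 = p
    rw [h]
    simp [coeff_X, coeff_C]
  have hu : IsUnit ((ρ σ : GL (Fin 2) A) : Matrix (Fin 2) (Fin 2) A).det :=
    (Matrix.isUnits_det_units (ρ σ))
  rw [hdet] at hu
  exact hu.ne_zero

/-- A place carries a Frobenius: if `ρ` has Frobenius characteristic polynomial `X² - sX + p` at `v`, then `p ≠ 0`. [folklore] -/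
theorem coeff_zero_ne_zero_of_hasFrobCharpolyAt [NumberField K] (ρ : FramedGaloisRep K A 2) {v : HeightOneSpectrum (𝓞 K)}
    {s p : A} (h : ρ.HasFrobCharpolyAt v (X ^ 2 - C s * X + C p)) : p ≠ 0 := by
  obtain ⟨𝔓, h𝔓⟩ := HeightOneSpectrum.primesAbove_nonempty v
  obtain ⟨σ, hσ⟩ := HeightOneSpectrum.exists_isArithFrobAt_of_mem_primesAbove_holds h𝔓
  exact coeff_zero_ne_zero_of_charpoly_eq_quadratic ρ σ (h 𝔓 h𝔓 σ hσ)

/-- The Satake polynomial of `{x, y}` at `q` for `GL₂`: `(X - q^{1/2}x)(X - q^{1/2}y)`. [folklore] -/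
theorem satakePolynomial_pair (q : ℕ) (x y : ℂ) :
    satakePolynomial ((({x, y} : Multiset ℂ)).map fun a ↦ (((Real.sqrt (q : ℝ)) : ℝ) : ℂ) ^ (2 - 1) * a) =
      X ^ 2 - C ((((Real.sqrt (q : ℝ)) : ℝ) : ℂ) * x + (((Real.sqrt (q : ℝ)) : ℝ) : ℂ) * y) * X +
        C (((((Real.sqrt (q : ℝ)) : ℝ) : ℂ) * x) * ((((Real.sqrt (q : ℝ)) : ℝ) : ℂ) * y)) := by
  unfold satakePolynomial
  simp only [Multiset.insert_eq_cons, Multiset.map_cons, Multiset.map_singleton, Multiset.prod_cons,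
    Multiset.prod_singleton, show (2 - 1 : ℕ) = 1 from rfl, pow_one, X_sub_C_mul_X_sub_C]

/-- `(u+v)/(uv) = u⁻¹ + v⁻¹` and `(uv)⁻¹ = u⁻¹ v⁻¹` for `u v ≠ 0`. [folklore] -/
theorem add_div_mul_eq_inv_add_inv {F : Type*} [Field F] {u v : F} (hu : u ≠ 0) (hv : v ≠ 0) :
    (u + v) / (u * v) = u⁻¹ + v⁻¹ := by
  field_simp
  ring

end Quadratic

/-! ## §2  The bridge at one place `w ∤ ℓ·Δ` -/

section Bridge

variable {K : Type} [Field K] [NumberField K]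

/-- **Weak ⟹ strong at a place `w ∤ ℓ Δ(E)`.**  Let `K` be totally real, `E / 𝓞 K` an integral model with `Δ(E) ≠ 0`,
`π` a weight-zero cuspidal automorphic representation of `GL₂(𝔸_K)` WEAKLY attached to `E` (at all but finitely many
`v`, `π_v` is unramified with Satake parameter `α` and `q_v^{1/2}(α₁+α₂) = a_v(E)`), and `ℓ` a prime.  Then at EVERY
finite place `w` with `w ∤ Δ(E)` and `w ∤ ℓ`, `π_w` is unramified and its Hecke polynomial is `X² - a_w(E) X + q_w`.
Proof: `r = r_{π,ι}` (lang.S27 + Ribet irreducibility, `exists_irreducible_galoisRep_GL2_totallyReal`), `ρ = ρ_{E,ℓ}`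
(`framedTateGaloisRep`) and its semisimplification `ρ'` (`FramedGaloisRep.exists_semisimplification`); at almost every `v`
the traces of Frobenius of `r^∨` and `ρ'` are `ι⁻¹(q_v^{1/2}(α₁+α₂)) = a_v` and `a_v` (Hasse–Weil,
`hasFrobCharpolyAt_rationalTateGaloisRepOf_of_hasGoodReductionAt`), so `ρ' ≅ r^∨` (§0); hence `r` is unramified at `w`
(Néron–Ogg–Shafarevich easy direction for `ρ`, transported), so `π_w` is unramified by CARAYOL (`hCar`), and the
compatibility at `w` (`IsGaloisCompatibleAt`, from `hCar`) compared with Hasse–Weil at one Frobenius above `w` gives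
`q_w^{1/2}(β₁+β₂) = a_w` AND `q_w β₁β₂ = q_w` for the Satake parameter `β` of `π_w`.  Modulo the three named print facts
`h27`, `hirr`, `hCar`; everything else is proved in the tree. [cite: CarayolASENS1986, Thm. (A)] [cite: Taylor1995HMFII, Thm. 1.1]
[cite: DeligneSerreASENS1974, Lemme 3.2] -/
theorem hasHeckePolynomialAt_of_weak_of_not_mem
    (h27 : exists_galoisRep_of_regularAlgebraic) (hirr : galoisRep_GL2_totallyReal_irreducible)
    (hCar : Carayol1986_unramifiedCompatibility) (hTR : IsTotallyReal K)
    {E : WeierstrassCurve (𝓞 K)} (hΔ : E.Δ ≠ 0)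
    {hcpt : isCompact_glFiniteIntegralLevel 2 K} (π : CuspidalAutomorphicRepData 2 K hcpt) (h0 : π.1.HasWeightZero)
    (hweak : ∀ᶠ v : HeightOneSpectrum (𝓞 K) in cofinite, ∃ α : Multiset ℂ, π.1.HasSatakeParamAt v α ∧
      ((Real.sqrt v.residueCard : ℝ) : ℂ) * α.sum = (frobTraceAt E v : ℂ))
    (ℓ : ℕ) [Fact ℓ.Prime] {w : HeightOneSpectrum (𝓞 K)} (hw : E.Δ ∉ w.asIdeal) (hℓw : ((ℓ : ℕ) : 𝓞 K) ∉ w.asIdeal) :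
    π.1.HasHeckePolynomialAt w ((frobPoly (frobTraceAt E w) w.residueCard).map (Int.castRingHom ℂ)) := by
  classical
  haveI hWell : (E.baseChange K).IsElliptic := (hasGoodReductionAt_baseChange_of_Δ_not_mem hw).isElliptic
  haveI hfin : Module.Finite ℚ_[ℓ] ((E.baseChange K).rationalTateModule ℓ) :=
    (E.baseChange K).module_finite_rationalTateModule_holds ℓ
  have hc : Continuous fun x : absoluteGaloisGroup K × (E.baseChange K).rationalTateModule ℓ =>
      rationalTateRepresentation (absoluteGaloisGroup K) (WeierstrassCurve.geomPoints (E.baseChange K)) ℓ x.1 x.2 :=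
    (E.baseChange K).continuous_rationalGaloisRepTate_holds ℓ
  obtain ⟨ι⟩ := PadicAlgCl.nonempty_ringEquiv_complex ℓ
  -- the arithmetic-Frobenius polynomial of a Satake pair, expanded (cf. the tree's `arithFrobPolyOfSatake_two_pair`)
  have hpair : ∀ (q : ℕ) (x y : ℂ), arithFrobPolyOfSatake ι q 2 ({x, y} : Multiset ℂ) =
      X ^ 2 - C ((ι.symm (((Real.sqrt q : ℝ) : ℂ) * x))⁻¹ + (ι.symm (((Real.sqrt q : ℝ) : ℂ) * y))⁻¹) * X +
        C ((ι.symm (((Real.sqrt q : ℝ) : ℂ) * x))⁻¹ * (ι.symm (((Real.sqrt q : ℝ) : ℂ) * y))⁻¹) := fun q x y => by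
    unfold arithFrobPolyOfSatake
    simp only [Multiset.insert_eq_cons, Multiset.map_cons, Multiset.map_singleton, Multiset.prod_cons,
      Multiset.prod_singleton, show (2 - 1 : ℕ) = 1 from rfl, pow_one, map_inv₀, X_sub_C_mul_X_sub_C]
  -- the Galois representation of `π`
  obtain ⟨r, hrirr, hr⟩ :=
    exists_irreducible_galoisRep_GL2_totallyReal h27 hirr hcpt hTR π h0.isRegularAlgebraic ℓ ι
  -- `ρ_{E,ℓ}` and its semisimplification
  obtain ⟨ρ', hρ'ss, -, -, hρ'unr, hρ'frob⟩ :=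
    FramedGaloisRep.exists_semisimplification ((E.baseChange K).framedTateGaloisRep ℓ)
  -- Hasse–Weil at every good place `v ∤ ℓ`
  have hHW : ∀ v : HeightOneSpectrum (𝓞 K), E.Δ ∉ v.asIdeal → ((ℓ : ℕ) : 𝓞 K) ∉ v.asIdeal →
      ρ'.HasFrobCharpolyAt v
        (X ^ 2 - C ((frobTraceAt E v : ℤ) : PadicAlgCl ℓ) * X + C ((v.residueCard : ℕ) : PadicAlgCl ℓ)) := by
    intro v hv hℓv
    have h1 := WeierstrassCurve.hasFrobCharpolyAt_rationalTateGaloisRepOf_of_hasGoodReductionAt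
      ((E.baseChange K).trace_galoisRepTate_frobenius_of_hasGoodReductionAt_holds ℓ)
      ((E.baseChange K).det_galoisRepTate_frobenius_of_hasGoodReductionAt_holds ℓ) hc hℓv
      (hasGoodReductionAt_baseChange_of_Δ_not_mem hv)
    have h2 := ((E.baseChange K).hasFrobCharpolyAt_framedTateGaloisRep_iff ℓ hc v _).2 h1
    have h3 := hρ'frob v _ h2
    rw [WeierstrassCurve.natCard_residueField_eq_residueCard, frobeniusTraceAt_baseChange_eq_frobTraceAt hv] at h3
    simpa [Polynomial.map_sub, Polynomial.map_add, Polynomial.map_mul, Polynomial.map_pow] using h3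
  -- the cofinitely many places where the weak clause holds and `v ∤ ℓ Δ`
  have hℓ0 : ((ℓ : ℕ) : 𝓞 K) ≠ 0 := Nat.cast_ne_zero.2 (Fact.out : ℓ.Prime).ne_zero
  have hev : ∀ᶠ v : HeightOneSpectrum (𝓞 K) in cofinite,
      (∃ α : Multiset ℂ, π.1.HasSatakeParamAt v α ∧
        ((Real.sqrt v.residueCard : ℝ) : ℂ) * α.sum = (frobTraceAt E v : ℂ)) ∧
        E.Δ ∉ v.asIdeal ∧ ((ℓ : ℕ) : 𝓞 K) ∉ v.asIdeal :=
    hweak.and ((eventually_not_mem_asIdeal hΔ).and (eventually_not_mem_asIdeal hℓ0))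
  -- (1) `ρ'` and `r^∨` have the same Frobenius traces at those places
  have htrace : ∀ᶠ v : HeightOneSpectrum (𝓞 K) in cofinite, ∀ 𝔓 ∈ v.primesAbove,
      ∀ σ : absoluteGaloisGroup K, IsArithFrobAt (𝓞 K) σ 𝔓 →
        FramedRep.trace ρ' σ = FramedRep.trace (FramedRep.dual r) σ := by
    filter_upwards [hev] with v hv
    obtain ⟨⟨α, hα, hsum⟩, hΔv, hℓv⟩ := hv
    intro 𝔓 h𝔓 σ hσ
    obtain ⟨x, y, rfl⟩ := Multiset.card_eq_two.1 hα.card_eq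
    obtain ⟨-, hrv⟩ := hr v _ hα hℓv
    rw [hpair] at hrv
    have hp := coeff_zero_ne_zero_of_charpoly_eq_quadratic r σ (hrv 𝔓 h𝔓 σ hσ)
    have hdual := FramedGaloisRep.hasFrobCharpolyAt_dual_fin_two hrv
    have h1 := trace_eq_of_charpoly_eq_quadratic _ σ (hdual 𝔓 h𝔓 σ hσ)
    have h2 := trace_eq_of_charpoly_eq_quadratic _ σ (hHW v hΔv hℓv 𝔓 h𝔓 σ hσ)
    have hs : ((Real.sqrt v.residueCard : ℝ) : ℂ) * (x + y) = (frobTraceAt E v : ℂ) := by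
      simpa [Multiset.insert_eq_cons, Multiset.sum_cons, Multiset.sum_singleton] using hsum
    rw [h1, h2, add_div_mul_eq_inv_add_inv (left_ne_zero_of_mul hp) (right_ne_zero_of_mul hp), inv_inv, inv_inv,
      ← map_add, ← mul_add, hs, map_intCast]
  -- (2) Chebotarev–Brauer–Nesbitt: `ρ' ≅ r^∨`
  have hdss : (FramedGaloisRep.toGaloisRep (FramedRep.dual r)).IsSemisimple := by
    haveI : (FramedGaloisRep.toGaloisRep (FramedRep.dual r)).toRepresentation.IsIrreducible :=
      FramedRep.isIrreducible_toContinuousRep_dual r hrirr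
    infer_instance
  obtain ⟨e⟩ := nonempty_equiv_of_trace_frobenius_eventually chebotarev_artinRep_holds ρ' (FramedRep.dual r)
    hρ'ss hdss htrace
  -- (3) at `w`: `ρ` unramified ⟹ `r` unramified ⟹ (Carayol) `π_w` unramified and compatible with `r`
  have hrunr : r.IsUnramifiedAt w :=
    (FramedGaloisRep.isUnramifiedAt_dual_iff w r).1 (FramedGaloisRep.isUnramifiedAt_of_equiv e
      (hρ'unr w ((E.baseChange K).isUnramifiedAt_framedTateGaloisRep ℓ
        (hasGoodReductionAt_baseChange_of_Δ_not_mem hw) hℓw)))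
  have hcompat : ∀ᶠ v : HeightOneSpectrum (𝓞 K) in cofinite, ∃ α : Multiset ℂ, π.1.HasSatakeParamAt v α ∧
      r.IsUnramifiedAt v ∧ r.HasFrobCharpolyAt v (arithFrobPolyOfSatake ι v.residueCard 2 α) := by
    filter_upwards [hev] with v hv
    obtain ⟨⟨α, hα, -⟩, -, hℓv⟩ := hv
    exact ⟨α, hα, hr v α hα hℓv⟩
  obtain ⟨hGC, hunr⟩ := hCar hcpt hTR π h0.isRegularAlgebraic ℓ ι r hrirr hcompat w hℓw
  obtain ⟨β, hβ⟩ := hunr hrunr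
  obtain ⟨x, y, rfl⟩ := Multiset.card_eq_two.1 hβ.card_eq
  obtain ⟨-, hrw⟩ := hGC {x, y} hβ
  rw [hpair] at hrw
  have hp := coeff_zero_ne_zero_of_hasFrobCharpolyAt r hrw
  have hdual := FramedGaloisRep.hasFrobCharpolyAt_dual_fin_two hrw
  -- (4) compare with Hasse–Weil at one Frobenius above `w`
  have hE := FramedGaloisRep.hasFrobCharpolyAt_of_equiv e (hHW w hw hℓw)
  obtain ⟨𝔓, h𝔓⟩ := HeightOneSpectrum.primesAbove_nonempty w
  obtain ⟨σ, hσ⟩ := HeightOneSpectrum.exists_isArithFrobAt_of_mem_primesAbove_holds h𝔓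
  obtain ⟨hs, hprod⟩ := coeff_quadratic_eq ((hE 𝔓 h𝔓 σ hσ).symm.trans (hdual 𝔓 h𝔓 σ hσ))
  rw [add_div_mul_eq_inv_add_inv (left_ne_zero_of_mul hp) (right_ne_zero_of_mul hp), inv_inv, inv_inv,
    ← map_add] at hs
  rw [mul_inv, inv_inv, inv_inv, ← map_mul] at hprod
  have hι₁ := congrArg ι hs
  have hι₂ := congrArg ι hprod
  simp only [map_intCast, map_natCast, RingEquiv.apply_symm_apply] at hι₁ hι₂
  -- (5) the Hecke polynomial
  refine ⟨{x, y}, hβ, ?_⟩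
  rw [satakePolynomial_pair, ← hι₁, ← hι₂]
  simp [frobPoly, Polynomial.map_sub, Polynomial.map_add, Polynomial.map_mul, Polynomial.map_pow]

/-! ## §3  Weak ⟹ strong (all places `w ∤ Δ`: `ℓ = 2` and `ℓ = 3`) -/

/-- **WEAK modularity ⟹ weight-zero automorphy (totally real base).**  For `K` totally real and an integral model
`E / 𝓞 K` with `Δ(E) ≠ 0`: a weight-zero cuspidal `π` on `GL₂(𝔸_K)` whose `T_v`-eigenvalue is `a_v(E)` at all but
finitely many `v` (the `π`-branch of `IsModularEllipticCurve` / the conclusion of `IsHilbertModular`) has Hecke polynomial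
`X² - a_w(E)X + q_w` at EVERY `w ∤ Δ(E)` — i.e. `E` is `IsAutomorphicOfWeightZero` by the same `π`.  From
`hasHeckePolynomialAt_of_weak_of_not_mem` at `ℓ = 2` and `ℓ = 3` (`w` divides at most one of them).  Modulo the named
print facts `h27` (lang.S27, Galois representations of regular algebraic `π`), `hirr` (Ribet irreducibility), `hCar`
(Carayol's local–global compatibility). [cite: CarayolASENS1986, Thm. (A)] [cite: Taylor1995HMFII, Thm. 1.1] -/
theorem isAutomorphicOfWeightZero_of_weak
    (h27 : exists_galoisRep_of_regularAlgebraic) (hirr : galoisRep_GL2_totallyReal_irreducible)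
    (hCar : Carayol1986_unramifiedCompatibility) (hTR : IsTotallyReal K)
    {E : WeierstrassCurve (𝓞 K)} (hΔ : E.Δ ≠ 0)
    {hcpt : isCompact_glFiniteIntegralLevel 2 K} (π : CuspidalAutomorphicRepData 2 K hcpt) (h0 : π.1.HasWeightZero)
    (hweak : ∀ᶠ v : HeightOneSpectrum (𝓞 K) in cofinite, ∃ α : Multiset ℂ, π.1.HasSatakeParamAt v α ∧
      ((Real.sqrt v.residueCard : ℝ) : ℂ) * α.sum = (frobTraceAt E v : ℂ)) :
    ∀ w : HeightOneSpectrum (𝓞 K), E.Δ ∉ w.asIdeal →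
      π.1.HasHeckePolynomialAt w ((frobPoly (frobTraceAt E w) w.residueCard).map (Int.castRingHom ℂ)) := by
  intro w hw
  -- `w` divides at most one of `2`, `3` (else `1 = 3 - 2 ∈ w`); cf. `FrobeniusUnitCarving.two_not_mem_or_three_not_mem`.
  have h23 : ((2 : ℕ) : 𝓞 K) ∉ w.asIdeal ∨ ((3 : ℕ) : 𝓞 K) ∉ w.asIdeal := by
    by_contra h
    rw [not_or, not_not, not_not] at h
    have h1 : ((3 : ℕ) : 𝓞 K) - ((2 : ℕ) : 𝓞 K) ∈ w.asIdeal := w.asIdeal.sub_mem h.2 h.1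
    rw [show ((3 : ℕ) : 𝓞 K) - ((2 : ℕ) : 𝓞 K) = 1 by norm_num] at h1
    exact w.isPrime.ne_top ((Ideal.eq_top_iff_one _).2 h1)
  rcases h23 with h2 | h3
  · haveI : Fact (Nat.Prime 2) := ⟨Nat.prime_two⟩
    exact hasHeckePolynomialAt_of_weak_of_not_mem h27 hirr hCar hTR hΔ π h0 hweak 2 hw h2
  · haveI : Fact (Nat.Prime 3) := ⟨Nat.prime_three⟩
    exact hasHeckePolynomialAt_of_weak_of_not_mem h27 hirr hCar hTR hΔ π h0 hweak 3 hw h3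

/-- **`IsModularEllipticCurve` (π-branch) ⟹ `IsAutomorphicOfWeightZero`** over a totally real field: a non-CM curve which is
modular in the weak sense of Caraiani–Newton / Freitas–Le Hung–Siksek is automorphic of weight zero in the tree's strong sense.
[cite: CarayolASENS1986, Thm. (A)] -/
theorem isAutomorphicOfWeightZero_of_isModularEllipticCurve_of_not_hasCM
    (h27 : exists_galoisRep_of_regularAlgebraic) (hirr : galoisRep_GL2_totallyReal_irreducible)
    (hCar : Carayol1986_unramifiedCompatibility) (hTR : IsTotallyReal K)
    {E : WeierstrassCurve (𝓞 K)} (hΔ : E.Δ ≠ 0) (hmod : IsModularEllipticCurve K E) (hCM : ¬ (E.baseChange K).HasCM) :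
    IsAutomorphicOfWeightZero E := by
  rcases hmod with h | ⟨hcpt, π, h0, hweak⟩
  · exact absurd h hCM
  · exact ⟨hcpt, π, h0, isAutomorphicOfWeightZero_of_weak h27 hirr hCar hTR hΔ π h0 hweak⟩

/-- **`IsHilbertModular` ⟹ `IsAutomorphicOfWeightZero`** over a totally real field (the converse of the tree's
`IsHilbertModular.of_isAutomorphicOfWeightZero`): Hilbert modularity in the cofinite sense of Freitas–Le Hung–Siksek / Box
upgrades to the Hecke polynomial at every place of good reduction of the model. [cite: CarayolASENS1986, Thm. (A)] -/
theorem isAutomorphicOfWeightZero_of_isHilbertModular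
    (h27 : exists_galoisRep_of_regularAlgebraic) (hirr : galoisRep_GL2_totallyReal_irreducible)
    (hCar : Carayol1986_unramifiedCompatibility) (hTR : IsTotallyReal K)
    {E : WeierstrassCurve (𝓞 K)} (hΔ : E.Δ ≠ 0) (hmod : IsHilbertModular E) : IsAutomorphicOfWeightZero E := by
  obtain ⟨hcpt, π, h0, hH⟩ := hmod
  refine ⟨hcpt, π, h0, isAutomorphicOfWeightZero_of_weak h27 hirr hCar hTR hΔ π h0 ?_⟩
  filter_upwards [hH] with v hv
  obtain ⟨α, hα, hsum, -⟩ := exists_hasSatakeParamAt_of_hasHeckePolynomialAt_frobPoly hv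
  exact ⟨α, hα, hsum⟩

/-- `IsHilbertModular E ↔ IsAutomorphicOfWeightZero E` for integral models over totally real fields, modulo the three
named print facts. [cite: CarayolASENS1986, Thm. (A)] -/
theorem isHilbertModular_iff_isAutomorphicOfWeightZero
    (h27 : exists_galoisRep_of_regularAlgebraic) (hirr : galoisRep_GL2_totallyReal_irreducible)
    (hCar : Carayol1986_unramifiedCompatibility) (hTR : IsTotallyReal K)
    {E : WeierstrassCurve (𝓞 K)} (hΔ : E.Δ ≠ 0) : IsHilbertModular E ↔ IsAutomorphicOfWeightZero E :=
  ⟨isAutomorphicOfWeightZero_of_isHilbertModular h27 hirr hCar hTR hΔ,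
    IsHilbertModular.of_isAutomorphicOfWeightZero hΔ⟩

/-- `IsModularEllipticCurve K E ↔ (CM ∨ IsAutomorphicOfWeightZero E)` over totally real `K`, modulo the three named
print facts. [cite: CarayolASENS1986, Thm. (A)] -/
theorem isModularEllipticCurve_iff_hasCM_or_isAutomorphicOfWeightZero
    (h27 : exists_galoisRep_of_regularAlgebraic) (hirr : galoisRep_GL2_totallyReal_irreducible)
    (hCar : Carayol1986_unramifiedCompatibility) (hTR : IsTotallyReal K)
    {E : WeierstrassCurve (𝓞 K)} (hΔ : E.Δ ≠ 0) :
    IsModularEllipticCurve K E ↔ (E.baseChange K).HasCM ∨ IsAutomorphicOfWeightZero E := by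
  constructor
  · rintro (h | ⟨hcpt, π, h0, hweak⟩)
    · exact Or.inl h
    · exact Or.inr ⟨hcpt, π, h0, isAutomorphicOfWeightZero_of_weak h27 hirr hCar hTR hΔ π h0 hweak⟩
  · rintro (h | h)
    · exact IsModularEllipticCurve.of_hasCM h
    · exact IsModularEllipticCurve.of_isAutomorphicOfWeightZero hΔ h

end Bridge

end Summit.Langlands.Langlands.Theorems.WeakStrongBridge
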